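import Mathlib
import Literature.NumberTheory.Transcendental.AssociatorsPairing
import Literature.NumberTheory.Transcendental.AssociatorsProofs
import HarnessLib

/-!
# The antipode of a group-like series; duality for pentagon solutions

For a non-commutative series `φ ∈ R⟨⟨α⟩⟩` which is group-like for the shuffle coproduct
(`NCSeries.IsGroupLike`: `c_u(φ) c_v(φ) = Σ_{w ∈ u ш v} c_w(φ)`, `c_∅(φ) = 1`), the series
`ψ := Σ_w (-1)^{|w|} c_{w̃}(φ) w` (`w̃` the reversed word, i.e. `ψ = S(φ)` for the antipode
`S(w) = (-1)^{|w|} w̃` of the shuffle Hopf algebra, Reutenauer 1993, §1.5–1.6) is the inverse of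
`φ` for the Cauchy (concatenation) product: `ψ · φ = 1` (`NCSeries.IsGroupLike.antipode_mul`).
The proof is the antipode identity `Σ_{w = uv} (-1)^{|u|} ũ ш v = ε(w)` of the shuffle Hopf
algebra, proved here in the coefficient form `NCSeries.sum_splits_shPair_reverse` for an arbitrary
functional `g : List α → R` from the decomposition of `(x a) ш v` according to the letters of `v`
following `a` (`NCSeries.shPair_append_singleton_left`).

Combined with Furusho's 2-cycle relation `φ(X,Y) φ(Y,X) = 1` for group-like solutions of
Drinfeld's pentagon equation (`NCSeries.DrinfeldPentagon.two_cycle`, Furusho 2010, Lemma 6) this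
gives `φ(Y,X) = S(φ)` (`NCSeries.DrinfeldPentagon.swapXY_apply_eq`), i.e. the **duality relation
for pentagon solutions**
`c_{τ(w)}(φ) = (-1)^{|w|} c_w(φ)` with `τ(w)` the word `w` read backwards with `X ↔ Y`
(`NCSeries.DrinfeldPentagon.apply_reverse_map_not`). At `φ = Φ_KZ` this is the duality
`ζ(s) = ζ(s†)` of multiple zeta values (Zagier 1994, §9; the sign `(-1)^{|w|}` is absorbed by
the sign convention `c_w(Φ_KZ) = (-1)^{dp(w)} ζ^ш(w)`).

References: C. Reutenauer, *Free Lie algebras* (1993), §1.5–1.6 [Reutenauer1993]; H. Furusho,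
*Pentagon and hexagon equations*, Ann. of Math. 171 (2010), Lemma 6 [Furusho2010].
Design: no new definitions (the antipode image is written as an explicit lambda); everything is
stated for the tree's `NCSeries.shPair` / `NCSeries.splits`.
-/

open scoped BigOperators

namespace Literature.NumberTheory.Transcendental

namespace NCSeries

section Antipode

variable {α : Type*} {R : Type*} [CommRing R]

/-- `Sh_g(∅, v) = g(v)`. [folklore] -/
theorem shPair_nil_left_apply (g : NCSeries α R) (v : List α) : shPair g [] v = g v := by
  simp [shPair]

/-- **Interleavings of `x a` with `v`, sorted by the letters of `v` placed after `a`**: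
`Sh_g(x a, v) = Σ_{v = v₁ v₂} Sh_{y ↦ g(y a v₂)}(x, v₁)`. [cite: Reutenauer1993, §1.4] -/
theorem shPair_append_singleton_left (a : α) :
    ∀ (x v : List α) (g : NCSeries α R), shPair g (x ++ [a]) v =
      ∑ p ∈ splits v, shPair (fun y => g (y ++ a :: p.2)) x p.1 := by
  intro x
  induction x with
  | nil =>
    intro v
    induction v with
    | nil =>
      intro g
      rw [sum_splits_nil', List.nil_append, shPair_nil_right, shPair_nil_right]
      rfl
    | cons b v ih =>
      intro g
      rw [List.nil_append, sum_splits_cons, shPair_cons_cons, shPair_nil_left_apply,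
        shPair_nil_left_apply, lderiv_apply, List.nil_append]
      congr 1
      rw [← List.nil_append [a], ih (lderiv b g)]
      refine Finset.sum_congr rfl fun p _ => ?_
      rw [shPair_nil_left_apply, shPair_nil_left_apply, lderiv_apply, List.cons_append]
  | cons c x ihx =>
    intro v
    induction v with
    | nil =>
      intro g
      rw [sum_splits_nil', List.cons_append, shPair_nil_right, shPair_nil_right]
      rfl
    | cons b v ihv =>
      intro g
      have ihv' := ihv (lderiv b g)
      rw [List.cons_append] at ihv'
      rw [List.cons_append, shPair_cons_cons, ihx (b :: v) (lderiv c g), sum_splits_cons,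
        sum_splits_cons, shPair_nil_right, shPair_nil_right, lderiv_apply,
        ihv', add_assoc, ← Finset.sum_add_distrib]
      congr 1
      refine Finset.sum_congr rfl fun p _ => ?_
      rw [shPair_cons_cons]
      rfl

/-- Re-association of iterated deconcatenations: cutting `w = u v` and then `v = v₁ v₂` is cutting
`w = r v₂` and then `r = u v₁`. [folklore] -/
theorem sum_splits_sum_splits_snd {M : Type*} [AddCommMonoid M] (F : List α → List α → List α → M) :
    ∀ w : List α, ∑ p ∈ splits w, ∑ q ∈ splits p.2, F p.1 q.1 q.2 =
      ∑ r ∈ splits w, ∑ s ∈ splits r.1, F s.1 s.2 r.2 := by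
  intro w
  induction w generalizing F with
  | nil => rw [sum_splits_nil', sum_splits_nil', sum_splits_nil', sum_splits_nil']
  | cons c w ih =>
    rw [sum_splits_cons, sum_splits_cons, sum_splits_cons, sum_splits_nil']
    simp only [sum_splits_cons, Finset.sum_add_distrib]
    rw [ih (fun u v₁ v₂ => F (c :: u) v₁ v₂), add_assoc]

/-- **The antipode identity of the shuffle Hopf algebra** in coefficient form: for every
functional `g` and every word `w`, `Σ_{w = uv} (-1)^{|u|} Sh_g(ũ, v) = [w = ∅] g(∅)`
(`ũ` = `u` reversed), i.e. `Σ_{w=uv} S(u) ш v = ε(w) 1` with `S(u) = (-1)^{|u|} ũ`.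
[cite: Reutenauer1993, §1.6] -/
theorem sum_splits_shPair_reverse :
    ∀ (n : ℕ) (w : List α) (g : NCSeries α R), w.length ≤ n →
      ∑ p ∈ splits w, (-1 : R) ^ p.1.length * shPair g p.1.reverse p.2 =
        if w = [] then g [] else 0 := by
  intro n
  induction n with
  | zero =>
    intro w g hw
    obtain rfl : w = [] := List.eq_nil_of_length_eq_zero (Nat.le_zero.mp hw)
    rw [sum_splits_nil', if_pos rfl]
    simp
  | succ n ih =>
    intro w g hw
    cases w with
    | nil =>
      rw [sum_splits_nil', if_pos rfl]
      simp
    | cons a w =>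
      rw [if_neg (List.cons_ne_nil a w), sum_splits_cons]
      simp only [List.length_nil, pow_zero, List.reverse_nil, one_mul, shPair_nil_left_apply,
        List.length_cons, List.reverse_cons, pow_succ]
      have hA : ∀ p ∈ splits w, (-1 : R) ^ p.1.length * -1 * shPair g (p.1.reverse ++ [a]) p.2 =
          -∑ q ∈ splits p.2, (-1 : R) ^ p.1.length *
            shPair (fun y => g (y ++ a :: q.2)) p.1.reverse q.1 := by
        intro p _
        rw [shPair_append_singleton_left, Finset.mul_sum, ← Finset.sum_neg_distrib]
        refine Finset.sum_congr rfl fun q _ => ?_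
        ring
      rw [Finset.sum_congr rfl hA, Finset.sum_neg_distrib,
        sum_splits_sum_splits_snd (fun u v₁ v₂ => (-1 : R) ^ u.length *
          shPair (fun y => g (y ++ a :: v₂)) u.reverse v₁)]
      have hI : ∀ r ∈ splits w, ∑ s ∈ splits r.1, (-1 : R) ^ s.1.length *
          shPair (fun y => g (y ++ a :: r.2)) s.1.reverse s.2 =
            if r.1 = [] then g (a :: r.2) else 0 := by
        intro r hr
        have hr' : r.1.length ≤ n := by
          have h1 := congrArg List.length (mem_splits.mp hr)
          rw [List.length_append] at h1
          rw [List.length_cons] at hw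
          omega
        rw [ih r.1 (fun y => g (y ++ a :: r.2)) hr']
        rfl
      rw [Finset.sum_congr rfl hI, Finset.sum_eq_single_of_mem (([] : List α), w)
        (nil_self_mem_splits w)]
      · rw [if_pos rfl, add_neg_cancel]
      · rintro ⟨u, v⟩ hp hne
        rw [if_neg]
        rintro (rfl : u = [])
        simp only [mem_splits, List.nil_append] at hp
        subst hp
        exact hne rfl

/-- **A group-like series is inverted by the antipode**: for `φ` group-like and `ψ` the series
`Σ_w (-1)^{|w|} c_{w̃}(φ) w` (`w̃` = `w` reversed), `ψ · φ = 1` in `R⟨⟨α⟩⟩` (the characters of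
the shuffle Hopf algebra form a group with inverse `φ ∘ S`). [cite: Reutenauer1993, §1.6] -/
theorem IsGroupLike.antipode_mul {φ ψ : NCSeries α R} (hg : IsGroupLike φ)
    (hψ : ∀ w, ψ w = (-1 : R) ^ w.length * φ w.reverse) : ψ * φ = 1 := by
  ext w
  rw [mul_apply]
  have h : ∀ p ∈ splits w, ψ p.1 * φ p.2 = (-1 : R) ^ p.1.length * shPair φ p.1.reverse p.2 := by
    intro p _
    rw [hψ, mul_assoc, hg.mul_eq_sum_shuffleWord]
    rfl
  rw [Finset.sum_congr rfl h, sum_splits_shPair_reverse w.length w φ le_rfl]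
  cases w with
  | nil => rw [if_pos rfl, hg.apply_nil, one_apply_nil]
  | cons a w => rw [if_neg (List.cons_ne_nil a w), one_apply_cons]

end Antipode

section Duality

variable {R : Type*} [CommRing R] [Algebra ℚ R]

/-- **`φ(Y,X)` is the antipode image of `φ`**: a group-like solution of Drinfeld's pentagon
satisfies `c_{w̄}(φ) = (-1)^{|w|} c_{w̃}(φ)` (`w̄` = letters exchanged, `w̃` = reversed), since
both `φ(Y,X)` (2-cycle relation, Furusho 2010, Lemma 6) and `S(φ)` are inverses of `φ` for the
Cauchy product. [cite: Furusho2010, Lemma 6] -/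
theorem DrinfeldPentagon.swapXY_apply_eq {φ : NCSeries Bool R} (h : DrinfeldPentagon φ)
    (hg : IsGroupLike φ) (w : List Bool) :
    swapXY φ w = (-1 : R) ^ w.length * φ w.reverse := by
  obtain ⟨ψ, hψ⟩ : ∃ ψ : NCSeries Bool R, ∀ w, ψ w = (-1 : R) ^ w.length * φ w.reverse :=
    ⟨fun w => (-1 : R) ^ w.length * φ w.reverse, fun _ => rfl⟩
  have h1 := (h.two_cycle hg).1
  have h2 := hg.antipode_mul hψ
  have : swapXY φ = ψ :=
    calc swapXY φ = 1 * swapXY φ := (one_mul _).symm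
      _ = ψ * φ * swapXY φ := by rw [h2]
      _ = ψ := by rw [mul_assoc, h1, mul_one]
  rw [this, hψ]

/-- **Duality for pentagon solutions**: for a group-like solution `φ` of Drinfeld's pentagon
equation over a commutative `ℚ`-algebra and every word `w`,
`c_{τ(w)}(φ) = (-1)^{|w|} c_w(φ)` where `τ(w)` is `w` reversed with the letters `X₀ ↔ X₁`
exchanged. At `φ = Φ_KZ` this is the duality of multiple zeta values `ζ(s†) = ζ(s)`.
[cite: Furusho2010, Lemma 6] -/
theorem DrinfeldPentagon.apply_reverse_map_not {φ : NCSeries Bool R} (h : DrinfeldPentagon φ)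
    (hg : IsGroupLike φ) (w : List Bool) :
    φ (w.reverse.map not) = (-1 : R) ^ w.length * φ w := by
  have := h.swapXY_apply_eq hg w.reverse
  rw [swapXY_apply] at this
  rw [this]
  simp only [List.length_reverse, List.reverse_reverse]

end Duality

end NCSeries

end Literature.NumberTheory.Transcendental
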